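import Literature.NumberTheory.Automorphic.UnitaryGroupMahlerRegion
import Literature.NumberTheory.Automorphic.UnitaryGroupRationalIsotropicLastRow
import Literature.NumberTheory.Automorphic.UnitaryGroupTruncatedKernelMeasurable
import Literature.NumberTheory.Automorphic.UnitaryGroupArthurTruncatedTrace
import Literature.NumberTheory.Automorphic.AutomorphicQuotientCoveringBound
import Literature.NumberTheory.Automorphic.GLnIwasawaIntegration
import HarnessLib

/-!
# Integrability of Arthur's truncated kernel on `U(3)` REDUCED TO THE CUSP ESTIMATE
# `∫_{B(F)-fundamental set ∩ {H > T}} |K(g,g) − K_B(g,g)| dg < ∞`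

Topic `NumberTheory/Automorphic`; namespace `Literature.NumberTheory.Automorphic.UnitaryGroup`.
Proof file: theorems only (no definition, no named fact, no instance, no `sorry`); imports = tree.
Setting of the named fact ★ `UnitaryGroup.TruncatedKernelIntegrable F E c`
(`UnitaryGroupArthurTruncatedTrace`): the quasi-split `U(J₃)` of `E/F` with involution `c`
(`c * c = 1`), Arthur's truncated kernel `k^T = truncatedKernel ν 𝓕 T f` along the Borel subgroup,
its descent `quotFun k^T` to `G(𝔸_F) ⧸ G(F)`, an automorphic measure `μ`.

MAIN THEOREM `truncatedKernelIntegrable_of_cusp_estimate` (§3): **`TruncatedKernelIntegrable F E c`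
holds as soon as (i) `U(J₃)(𝔸_F)` is unimodular and (ii) THE CUSP ESTIMATE holds: for every Haar
measure `ν_G` of `G(𝔸_F)`, all data `ν, 𝓕` and every test function `f` there is `T₁` such that for
`T > T₁` some Borel set `D` meeting every `B(F)`-orbit (`∀ g, ∃ β ∈ B(F), β g ∈ D`) has
`∫_{D ∩ {H > T}} ‖K(g, g) − K_B(g, g)‖ dν_G(g) < ∞`.** Neither a Siegel set nor a fundamental domain
nor any local boundedness enters the hypotheses: the proof is the POINTWISE DICHOTOMY (§2)

  `‖k^T(y)‖ ≤ C_T + Σ_{γ ∈ G(F)} (1_{D ∩ {H > T}} · ‖K − K_B‖)(γ y)`   (`T ≥ 1`, all `y`),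

— if no rational translate of `y` is above the cut-off then `k^T(y) = K(y, y)` (★
`truncatedKernel_eq_kernel_of_forall_le`) and `y` lies in the Mahler region of level `T⁻¹`
(an anisotropic `ξ` has `h(ξ y) ≥ 1` by Godement's pairing inequality ★
`isotropic_of_vecHeight_vecMul_lt_one`; an isotropic one is `a · e₃ γ` by Witt ★
`exists_rational_lastRow_eq_smul`, so `h(ξ y) = H(γ y)⁻¹ ≥ T⁻¹`), where `|K(y, y)| ≤ C_T` (★
`exists_forall_norm_kernel_le`, Mahler's criterion modulo `G(F)`); otherwise EXACTLY ONE class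
`B(F) γ₀` is above the cut-off (Siegel property ★ `borelHeight_mul_lt_one_of_not_mem_arithmeticBorel`),
`k^T(y) = K(z, z) − K_B(z, z)` at `z = γ₀ y` (★ `kernel_diag_rational_mul`), and `z` may be moved into
`D` by `B(F)` (★ `kernelBorel_diag_rational_borel_mul`, ★ `borelHeight_rational_borel_mul`) —
integrated over `G(𝔸_F) ⧸ G(F)` by WEIL'S FORMULA for the discrete `G(F)` (★
`LevelOrbit.lintegral_fiberLIntegral_count_eq`: `∫_{G⧸Γ} Σ_γ F(gγ) dμ = c ∫_G F dν_G`) and the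
inversion invariance of `ν_G` (unimodularity, ★ `isInvInvariant_of_isMulRightInvariant`); the
measurability of `quotFun k^T` is ★ `aestronglyMeasurable_quotFun_truncatedKernel`. (Rogawski (1990),
§2.2 p. 13: «for `T` sufficiently regular, `k^T(x)` is integrable over `𝐙G\𝐆`»; Arthur (1978), §7;
Gelbart (1975), §9.B for `GL₂`.) The cusp estimate (ii) is the product of ★
`UnitaryGroupTruncatedKernelCellBound` (`|K − K_B| ≤ #R · ω` high in the cusp) with the count of
`R`, the oscillation of `f` and Haar measure in Iwasawa coordinates — separate bricks.

* §1 `IsQuasiSplitTest.continuous'`, `IsQuasiSplitTest.hasCompactSupport'` — test functions by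
  restriction are continuous of compact support.
* §2 `norm_truncatedKernel_le_of_dichotomy` — the pointwise dichotomy bound.
* §3 the main theorem.

## References

* J. D. Rogawski, *Automorphic Representations of Unitary Groups in Three Variables* (1990), §2.2
  [Rogawski1990].
* S. Gelbart, *Automorphic forms on adele groups* (1975), §9.B [Gelbart1975].
* A. Borel, *Some finiteness properties of adele groups over number fields* (1963), §5 [Borel1963].
-/

set_option autoImplicit false

noncomputable section

open MeasureTheory Measure NumberField IsDedekindDomain Set Matrix
open Literature.MeasureTheory.Group
open scoped NNReal ENNReal Pointwise

namespace Literature.NumberTheory.Automorphic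

namespace UnitaryGroup

variable {F E : Type} [Field F] [NumberField F] [Field E] [NumberField E] [Algebra F E]
  {c : E ≃ₐ[F] E}

/-! ## §1 Test functions by restriction are continuous of compact support -/

section Test

variable {N : ℕ}

/-- `𝔸_E` is Hausdorff (local copy of the standard argument). [cite: Rogawski1990, §2.1 (p. 11)] -/
private theorem t2Space_adeleRing_E₈ : T2Space (AdeleRing (𝓞 E) E) := by
  haveI : T2Space (FiniteAdeleRing (𝓞 E) E) := inferInstanceAs <| T2Space
    (RestrictedProduct (fun w : IsDedekindDomain.HeightOneSpectrum (𝓞 E) => w.adicCompletion E)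
      (fun w => (w.adicCompletionIntegers E : Set (w.adicCompletion E))) Filter.cofinite)
  haveI : T2Space (InfiniteAdeleRing E) :=
    inferInstanceAs <| T2Space ((w : InfinitePlace E) → w.Completion)
  exact inferInstanceAs <| T2Space (InfiniteAdeleRing E × FiniteAdeleRing (𝓞 E) E)

/-- A test function by restriction is continuous. [cite: Rogawski1990, §2.1 (pp. 11–12)] -/
theorem IsQuasiSplitTest.continuous' {f : (quasiSplit F E c N).Adelic → ℂ}
    (hf : IsQuasiSplitTest F E c N f) : Continuous f := by
  obtain ⟨η₁, η₂, h₁, h₂, hf⟩ := hf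
  have hval : Continuous fun g : (quasiSplit F E c N).Adelic => adelicVal F E c N _ g :=
    continuous_subtype_val
  have e : f = fun g => ((η₁ (adelicVal F E c N _ g) : ℝ) : ℂ) +
      ((η₂ (adelicVal F E c N _ g) : ℝ) : ℂ) * Complex.I := funext hf
  rw [e]
  exact (Complex.continuous_ofReal.comp (h₁.continuous.comp hval)).add
    ((Complex.continuous_ofReal.comp (h₂.continuous.comp hval)).mul continuous_const)

/-- A test function by restriction has compact support (`U(J_N)(𝔸_F) ≤ GL_N(𝔸_E)` is closed, ★
`isClosed_unitaryGroupOfForm_conjAdele`). [cite: Rogawski1990, §2.1 (pp. 11–12)] -/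
theorem IsQuasiSplitTest.hasCompactSupport' {f : (quasiSplit F E c N).Adelic → ℂ}
    (hf : IsQuasiSplitTest F E c N f) : HasCompactSupport f := by
  haveI := t2Space_adeleRing_E₈ (E := E)
  obtain ⟨η₁, η₂, h₁, h₂, hf⟩ := hf
  have hcl : IsClosed ((adelic F E c N ((StdForm.antidiagonal N).over E) :
      Subgroup (GL (Fin N) (AdeleRing (𝓞 E) E))) : Set (GL (Fin N) (AdeleRing (𝓞 E) E))) :=
    isClosed_unitaryGroupOfForm_conjAdele F E c _
  have hK : IsCompact ((Subtype.val : (quasiSplit F E c N).Adelic → GL (Fin N) (AdeleRing (𝓞 E) E)) ⁻¹'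
      (tsupport η₁ ∪ tsupport η₂)) :=
    hcl.isClosedEmbedding_subtypeVal.isCompact_preimage (h₁.hasCompactSupport.union h₂.hasCompactSupport)
  refine HasCompactSupport.of_support_subset_isCompact hK fun g hg => ?_
  rw [Function.mem_support, hf g] at hg
  by_contra h
  have h1 : η₁ (adelicVal F E c N _ g) = 0 := image_eq_zero_of_notMem_tsupport fun hh => h (Or.inl hh)
  have h2 : η₂ (adelicVal F E c N _ g) = 0 := image_eq_zero_of_notMem_tsupport fun hh => h (Or.inr hh)
  exact hg (by rw [h1, h2]; simp)

end Test

/-! ## §2 The pointwise dichotomy -/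

section Three

variable [MeasurableSpace (adelicUnipotent F E c 3)] [BorelSpace (adelicUnipotent F E c 3)]

omit [MeasurableSpace (adelicUnipotent F E c 3)] [BorelSpace (adelicUnipotent F E c 3)] in
/-- **Below the cut-off everywhere ⇒ in the Mahler region.** If no rational translate of `y` has
height `> T` (`T ≥ 1`), then every rational vector has `h(ξ y) ≥ T⁻¹`: an anisotropic `ξ` has
`h(ξ y) ≥ 1` (Godement), an isotropic one is `a · e₃ γ` (Witt) with `h(ξ y) = H(γ y)⁻¹`.
[cite: Godement1964, §1.1 and §3] -/
theorem forall_inv_le_vecHeight_of_forall_borelHeight_le (hc : c * c = 1) {T : ℝ≥0} (hT : 1 ≤ T)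
    {y : (quasiSplit F E c 3).Adelic}
    (hy : ∀ γ : (quasiSplit F E c 3).arithmeticSubgroup,
      borelHeight ((γ : (quasiSplit F E c 3).Adelic) * y) ≤ T) :
    ∀ ξ : Fin 3 → E, ξ ≠ 0 →
      T⁻¹ ≤ vecHeight E (principalVec E ξ ᵥ* (adelicVal F E c 3 _ y : Matrix (Fin 3) (Fin 3) (AdeleRing (𝓞 E) E))) := by
  intro ξ hξ
  have hT0 : 0 < T := lt_of_lt_of_le zero_lt_one hT
  by_cases hiso : ∑ i, ξ i * c (ξ (Fin.rev i)) = 0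
  · -- isotropic: `ξ = a · e₃ γ`, `h(ξ y) = H(γ y)⁻¹ ≥ T⁻¹`
    obtain ⟨γ, a, ha, hrow⟩ := exists_rational_lastRow_eq_smul hc hξ hiso
    have hlast : lastRow ((quasiSplit F E c 3).toAdelic γ * y) =
        algebraMap E (AdeleRing (𝓞 E) E) a •
          (principalVec E ξ ᵥ* (adelicVal F E c 3 _ y : Matrix (Fin 3) (Fin 3) (AdeleRing (𝓞 E) E))) := by
      rw [lastRow_mul, lastRow_toAdelic, hrow, principalVec_smul, Matrix.smul_vecMul]
    have hfin : IsHeightFinite E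
        (principalVec E ξ ᵥ* (adelicVal F E c 3 _ y : Matrix (Fin 3) (Fin 3) (AdeleRing (𝓞 E) E))) :=
      isHeightFinite_principalVec_vecMul hξ _
    have hH : borelHeight ((quasiSplit F E c 3).toAdelic γ * y) =
        (vecHeight E (principalVec E ξ ᵥ* (adelicVal F E c 3 _ y : Matrix (Fin 3) (Fin 3) (AdeleRing (𝓞 E) E))))⁻¹ := by
      rw [borelHeight_def, hlast]
      exact congrArg _ (vecHeight_smul_algebraMap hfin (Units.mk0 a ha))
    have hle := hy ⟨(quasiSplit F E c 3).toAdelic γ, ⟨γ, rfl⟩⟩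
    change borelHeight ((quasiSplit F E c 3).toAdelic γ * y) ≤ T at hle
    rw [hH] at hle
    -- `h⁻¹ ≤ T ⇒ T⁻¹ ≤ h`
    have hpos : 0 < vecHeight E
        (principalVec E ξ ᵥ* (adelicVal F E c 3 _ y : Matrix (Fin 3) (Fin 3) (AdeleRing (𝓞 E) E))) := by
      have h1 := one_le_matHeightBound_mul_vecHeight (K := E) hξ (adelicVal F E c 3 _ y)
      by_contra h
      rw [not_lt, le_zero_iff] at h
      rw [h, mul_zero] at h1
      exact absurd h1 (not_le.2 zero_lt_one)
    exact (inv_le_comm₀ hpos hT0).1 hle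
  · -- anisotropic: `h(ξ y) ≥ 1 ≥ T⁻¹`
    have h1 : 1 ≤ vecHeight E
        (principalVec E ξ ᵥ* (adelicVal F E c 3 _ y : Matrix (Fin 3) (Fin 3) (AdeleRing (𝓞 E) E))) := by
      by_contra h
      exact hiso (isotropic_of_vecHeight_vecMul_lt_one y (not_le.1 h))
    exact (inv_le_one_of_one_le₀ hT).trans h1

/-- **THE POINTWISE DICHOTOMY BOUND.** Let `T ≥ 1`, `ν` Haar, `𝓕` a fundamental domain of `N(F)`,
`f` arbitrary, `C` a bound for `|K(y, y)|` on the Mahler region of level `T⁻¹`, and `D ⊆ G(𝔸_F)`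
meeting every `B(F)`-orbit. Then for every `y`,
`‖k^T(y)‖ ≤ C + Σ'_{γ ∈ G(F)} (1_{D ∩ {H > T}} ‖K − K_B‖)(γ y)`. [cite: Rogawski1990, §2.2 (p. 13)] -/
theorem enorm_truncatedKernel_le_of_dichotomy (hc : c * c = 1) (ν : Measure (adelicUnipotent F E c 3))
    [ν.IsHaarMeasure] {𝓕 : Set (adelicUnipotent F E c 3)}
    (h𝓕 : IsFundamentalDomain (rationalUnipotent F E c 3) 𝓕 ν) (f : (quasiSplit F E c 3).Adelic → ℂ)
    {T : ℝ≥0} (hT : 1 ≤ T) {C : ℝ}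
    (hC : ∀ g : (quasiSplit F E c 3).Adelic,
      (∀ ξ : Fin 3 → E, ξ ≠ 0 →
        T⁻¹ ≤ vecHeight E (principalVec E ξ ᵥ* (adelicVal F E c 3 _ g : Matrix (Fin 3) (Fin 3) (AdeleRing (𝓞 E) E)))) →
      ‖kernel f g g‖ ≤ C)
    {D : Set (quasiSplit F E c 3).Adelic}
    (hD : ∀ g : (quasiSplit F E c 3).Adelic, ∃ β : (quasiSplit F E c 3).arithmeticSubgroup,
      β ∈ arithmeticBorel F E c 3 ∧ (β : (quasiSplit F E c 3).Adelic) * g ∈ D)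
    (y : (quasiSplit F E c 3).Adelic) :
    ‖truncatedKernel ν 𝓕 T f y‖ₑ ≤ ENNReal.ofReal C +
      ∑' γ : (quasiSplit F E c 3).arithmeticSubgroup,
        (D ∩ {g | T < borelHeight g}).indicator
          (fun g => (‖kernel f g g - kernelBorel ν 𝓕 f g g‖ₑ : ℝ≥0∞))
          ((γ : (quasiSplit F E c 3).Adelic) * y) := by
  classical
  by_cases hex : ∃ γ : (quasiSplit F E c 3).arithmeticSubgroup,
      T < borelHeight ((γ : (quasiSplit F E c 3).Adelic) * y)
  · -- exactly one class above the cut-off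
    obtain ⟨γ₀, hγ₀⟩ := hex
    have hT1 : 1 < borelHeight ((γ₀ : (quasiSplit F E c 3).Adelic) * y) := lt_of_le_of_lt hT hγ₀
    set q₀ : Quotient (QuotientGroup.rightRel (arithmeticBorel F E c 3)) := Quotient.mk _ γ₀ with hq₀
    -- every class above `T` is `q₀`
    have huniq : ∀ q : Quotient (QuotientGroup.rightRel (arithmeticBorel F E c 3)),
        T < borelHeight (((q.out : (quasiSplit F E c 3).arithmeticSubgroup) : (quasiSplit F E c 3).Adelic) * y) →
          q = q₀ := by
      intro q hq
      -- `q.out = δ γ₀` with `δ = q.out γ₀⁻¹`; if `δ ∉ B(F)` then `H(q.out y) < 1`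
      set δ : (quasiSplit F E c 3).arithmeticSubgroup := q.out * γ₀⁻¹ with hδ
      have hqout : ((q.out : (quasiSplit F E c 3).arithmeticSubgroup) : (quasiSplit F E c 3).Adelic) * y =
          (δ : (quasiSplit F E c 3).Adelic) * (((γ₀ : (quasiSplit F E c 3).Adelic)) * y) := by
        rw [hδ, Subgroup.coe_mul, Subgroup.coe_inv]; group
      have hδB : δ ∈ arithmeticBorel F E c 3 := by
        by_contra hδB
        have hlt := borelHeight_mul_lt_one_of_not_mem_arithmeticBorel hδB hT1
        rw [← hqout] at hlt
        exact absurd (hT.trans hq.le) (not_le.2 hlt)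
      rw [hq₀]
      rw [← Quotient.out_eq q]
      exact Quotient.sound (QuotientGroup.rightRel_apply.2 (by
        rw [show γ₀ * (q.out : (quasiSplit F E c 3).arithmeticSubgroup)⁻¹ = δ⁻¹ by
          rw [hδ, _root_.mul_inv_rev, inv_inv]]
        exact inv_mem hδB))
    -- the representative `z = q₀.out y` is `β₀ γ₀ y` with `β₀ ∈ B(F)`, so still above `T`
    set z : (quasiSplit F E c 3).Adelic :=
      ((q₀.out : (quasiSplit F E c 3).arithmeticSubgroup) : (quasiSplit F E c 3).Adelic) * y with hz
    have hβ₀ : (q₀.out : (quasiSplit F E c 3).arithmeticSubgroup) * γ₀⁻¹ ∈ arithmeticBorel F E c 3 := by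
      have h : @Setoid.r _ (QuotientGroup.rightRel (arithmeticBorel F E c 3)) q₀.out γ₀ :=
        Quotient.mk_out (s := QuotientGroup.rightRel (arithmeticBorel F E c 3)) γ₀
      have h' := QuotientGroup.rightRel_apply.1 h
      rw [show (q₀.out : (quasiSplit F E c 3).arithmeticSubgroup) * γ₀⁻¹ =
        (γ₀ * (q₀.out : (quasiSplit F E c 3).arithmeticSubgroup)⁻¹)⁻¹ by rw [_root_.mul_inv_rev, inv_inv]]
      exact inv_mem h'
    have hzT : T < borelHeight z := by
      have hz' : z = (((q₀.out * γ₀⁻¹ : (quasiSplit F E c 3).arithmeticSubgroup)) : (quasiSplit F E c 3).Adelic) *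
          (((γ₀ : (quasiSplit F E c 3).Adelic)) * y) := by
        rw [hz, Subgroup.coe_mul, Subgroup.coe_inv]; group
      obtain ⟨b₀, hb₀⟩ := MonoidHom.mem_range.mp (q₀.out * γ₀⁻¹).2
      rw [hz', ← hb₀, borelHeight_rational_borel_mul b₀ (by
        rw [hb₀]; exact (mem_arithmeticBorel_iff _).1 hβ₀)]
      exact hγ₀
    -- `k^T(y) = K(y,y) − K_B(z,z) = K(z,z) − K_B(z,z)`
    have hsum : pseudoEisenstein (kernelBorelTail ν 𝓕 T f) y = kernelBorel ν 𝓕 f z z := by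
      rw [pseudoEisenstein_def, finsum_eq_single _ q₀]
      · exact kernelBorelTail_of_lt f hzT
      · intro q hq
        by_contra hne
        have hlt : T < borelHeight (((q.out : (quasiSplit F E c 3).arithmeticSubgroup) :
            (quasiSplit F E c 3).Adelic) * y) := by
          by_contra hle
          exact hne (kernelBorelTail_of_not_lt f hle)
        exact hq (huniq q hlt)
    have hkT : truncatedKernel ν 𝓕 T f y = kernel f z z - kernelBorel ν 𝓕 f z z := by
      rw [truncatedKernel_def, hsum, hz, kernel_diag_rational_mul]
    -- move `z` into `D` by `β ∈ B(F)`
    obtain ⟨β, hβB, hβD⟩ := hD z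
    have hzβ : kernel f z z - kernelBorel ν 𝓕 f z z =
        kernel f ((β : (quasiSplit F E c 3).Adelic) * z) ((β : (quasiSplit F E c 3).Adelic) * z) -
          kernelBorel ν 𝓕 f ((β : (quasiSplit F E c 3).Adelic) * z) ((β : (quasiSplit F E c 3).Adelic) * z) := by
      rw [kernel_diag_rational_mul f β z, kernelBorel_diag_rational_borel_mul ν h𝓕 f β hβB z]
    have hβzT : T < borelHeight ((β : (quasiSplit F E c 3).Adelic) * z) := by
      obtain ⟨b, hb⟩ := MonoidHom.mem_range.mp β.2
      rw [← hb, borelHeight_rational_borel_mul b (by rw [hb]; exact (mem_arithmeticBorel_iff _).1 hβB)]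
      exact hzT
    -- the term of the sum at `γ' = β q₀.out`
    set γ' : (quasiSplit F E c 3).arithmeticSubgroup := β * q₀.out with hγ'
    have hγ'y : (γ' : (quasiSplit F E c 3).Adelic) * y = (β : (quasiSplit F E c 3).Adelic) * z := by
      rw [hγ', Subgroup.coe_mul, hz, mul_assoc]
    have hterm : (‖truncatedKernel ν 𝓕 T f y‖ₑ : ℝ≥0∞) =
        (D ∩ {g | T < borelHeight g}).indicator
          (fun g => (‖kernel f g g - kernelBorel ν 𝓕 f g g‖ₑ : ℝ≥0∞))
          ((γ' : (quasiSplit F E c 3).Adelic) * y) := by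
      rw [hγ'y, Set.indicator_of_mem (Set.mem_inter hβD hβzT), hkT, hzβ]
    calc (‖truncatedKernel ν 𝓕 T f y‖ₑ : ℝ≥0∞)
        ≤ ∑' γ : (quasiSplit F E c 3).arithmeticSubgroup,
            (D ∩ {g | T < borelHeight g}).indicator
              (fun g => (‖kernel f g g - kernelBorel ν 𝓕 f g g‖ₑ : ℝ≥0∞))
              ((γ : (quasiSplit F E c 3).Adelic) * y) := by rw [hterm]; exact ENNReal.le_tsum γ'
      _ ≤ _ := le_add_self
  · -- no class above the cut-off: `k^T = K` and `y` in the Mahler region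
    rw [not_exists] at hex
    have hle : ∀ γ : (quasiSplit F E c 3).arithmeticSubgroup,
        borelHeight ((γ : (quasiSplit F E c 3).Adelic) * y) ≤ T := fun γ => not_lt.1 (hex γ)
    rw [truncatedKernel_eq_kernel_of_forall_le f hle]
    have hK : ‖kernel f y y‖ ≤ C := hC y (forall_inv_le_vecHeight_of_forall_borelHeight_le hc hT hle)
    calc (‖kernel f y y‖ₑ : ℝ≥0∞) ≤ ENNReal.ofReal C := by
          rw [← ofReal_norm]; exact ENNReal.ofReal_le_ofReal hK
      _ ≤ _ := le_self_add


end Three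

/-! ## §3 The assembly modulo the cusp estimate -/

/-- **INTEGRABILITY OF THE TRUNCATED KERNEL FROM THE CUSP ESTIMATE.** `TruncatedKernelIntegrable F E c`
(★ the named fact of `UnitaryGroupArthurTruncatedTrace`: for all Haar `ν` on `N(𝔸_F)`, fundamental
domains `𝓕`, automorphic `μ` and test functions `f`, `[g] ↦ k^T(g⁻¹)` is `μ`-integrable for
`T > T₀`) holds provided (i) `U(J₃)(𝔸_F)` is unimodular (every Haar measure is right invariant; ★
for CM data `isMulRightInvariant_adelicUnitaryGroup_three` ∕ `modularCharacter_cmDatum_three_eq_one`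
with ★ `isMulRightInvariant_of_modularCharacterFun_eq_one`) and (ii) THE CUSP ESTIMATE: for every Haar measure `ν_G` on
`U(J₃)(𝔸_F)` and all `ν, 𝓕, f` there is `T₁` such that for every `T > T₁` some Borel `D ⊆ U(J₃)(𝔸_F)`
meeting every `B(F)`-orbit satisfies `∫⁻_{D ∩ {T < H}} ‖K(g,g) − K_B(g,g)‖ₑ dν_G < ∞`.
[cite: Rogawski1990, §2.2 (p. 13)] [cite: Gelbart1975, §9.B (9.44)–(9.46)] -/
theorem truncatedKernelIntegrable_of_cusp_estimate (hc : c * c = 1)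
    (hunimod : ∀ [MeasurableSpace (quasiSplit F E c 3).Adelic] [BorelSpace (quasiSplit F E c 3).Adelic]
      (νG : Measure (quasiSplit F E c 3).Adelic), νG.IsHaarMeasure → νG.IsMulRightInvariant)
    (hcusp : ∀ [MeasurableSpace (adelicUnipotent F E c 3)] [BorelSpace (adelicUnipotent F E c 3)]
      [MeasurableSpace (quasiSplit F E c 3).Adelic] [BorelSpace (quasiSplit F E c 3).Adelic]
      (νG : Measure (quasiSplit F E c 3).Adelic) [νG.IsHaarMeasure]
      (ν : Measure (adelicUnipotent F E c 3)) [ν.IsHaarMeasure] (𝓕 : Set (adelicUnipotent F E c 3)),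
      IsFundamentalDomain (rationalUnipotent F E c 3) 𝓕 ν →
      ∀ (f : (quasiSplit F E c 3).Adelic → ℂ), IsQuasiSplitTest F E c 3 f →
      ∃ T₁ : ℝ≥0, ∀ T : ℝ≥0, T₁ < T → ∃ D : Set (quasiSplit F E c 3).Adelic, MeasurableSet D ∧
        (∀ g : (quasiSplit F E c 3).Adelic, ∃ β : (quasiSplit F E c 3).arithmeticSubgroup,
          β ∈ arithmeticBorel F E c 3 ∧ (β : (quasiSplit F E c 3).Adelic) * g ∈ D) ∧
        ∫⁻ g in D ∩ {g | T < borelHeight g}, ‖kernel f g g - kernelBorel ν 𝓕 f g g‖ₑ ∂νG < ∞) :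
    TruncatedKernelIntegrable F E c := by
  intro _ _ ν _ 𝓕 h𝓕 μ _ f hf
  classical
  -- topology and Borel structure of `G = U(J₃)(𝔸_F)`
  haveI := secondCountableTopology_adeleRing E
  haveI := locallyCompactSpace_adeleRing' E
  haveI := t2Space_adeleRing_E₈ (E := E)
  haveI : T2Space (quasiSplit F E c 3).Adelic :=
    inferInstanceAs (T2Space (adelic F E c 3 ((StdForm.antidiagonal 3).over E)))
  haveI : LocallyCompactSpace (quasiSplit F E c 3).Adelic :=
    inferInstanceAs (LocallyCompactSpace (adelic F E c 3 ((StdForm.antidiagonal 3).over E)))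
  haveI : SecondCountableTopology (quasiSplit F E c 3).Adelic :=
    inferInstanceAs (SecondCountableTopology (adelic F E c 3 ((StdForm.antidiagonal 3).over E)))
  letI : MeasurableSpace (quasiSplit F E c 3).Adelic := borel _
  haveI : BorelSpace (quasiSplit F E c 3).Adelic := ⟨rfl⟩
  -- a Haar measure of `G`, right and inversion invariant by unimodularity
  obtain ⟨K₀⟩ := (inferInstance : Nonempty (TopologicalSpace.PositiveCompacts (quasiSplit F E c 3).Adelic))
  set νG : Measure (quasiSplit F E c 3).Adelic := Measure.haarMeasure K₀ with hνG
  haveI : νG.IsMulRightInvariant := hunimod νG inferInstance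
  haveI : νG.IsInvInvariant := isInvInvariant_of_isMulRightInvariant νG
  -- the data
  have hfc : Continuous f := hf.continuous'
  have hfs : HasCompactSupport f := hf.hasCompactSupport'
  obtain ⟨T₁, hT₁⟩ := hcusp νG ν 𝓕 h𝓕 f hf
  refine ⟨max T₁ 1, fun T hT => ?_⟩
  have hT1 : 1 ≤ T := (le_max_right T₁ 1).trans hT.le
  have hT0 : 0 < T := lt_of_lt_of_le zero_lt_one hT1
  obtain ⟨D, hDm, hDcov, hDint⟩ := hT₁ T ((le_max_left T₁ 1).trans_lt hT)
  -- the bound on the Mahler region of level `T⁻¹`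
  obtain ⟨Cb, hCb⟩ := exists_forall_norm_kernel_le (F := F) (E := E) (c := c) (N := 3)
    (ε := T⁻¹) (inv_pos.2 hT0) hfc hfs
  -- `N(𝔸_F)` is a closed subgroup: second countable, locally compact, so `ν` is s-finite
  have hNcl : IsClosed ((adelicUnipotent F E c 3 : Set (quasiSplit F E c 3).Adelic)) := by
    change IsClosed (⇑(adelicVal F E c 3 ((StdForm.antidiagonal 3).over E)) ⁻¹'
      ((upperUnitriangular (Fin 3) (AdeleRing (𝓞 E) E) : Subgroup (GL (Fin 3) (AdeleRing (𝓞 E) E))) :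
        Set (GL (Fin 3) (AdeleRing (𝓞 E) E))))
    exact (isClosed_upperUnitriangular (R := AdeleRing (𝓞 E) E)).preimage continuous_subtype_val
  haveI : SecondCountableTopology (adelicUnipotent F E c 3) := TopologicalSpace.Subtype.secondCountableTopology _
  haveI : LocallyCompactSpace (adelicUnipotent F E c 3) := hNcl.locallyCompactSpace
  haveI : SFinite ν := inferInstance
  -- the majorant `Dψ = 1_{D ∩ {T < H}} ‖K − K_B‖ₑ`
  set Dψ : (quasiSplit F E c 3).Adelic → ℝ≥0∞ := (D ∩ {g | T < borelHeight g}).indicator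
    fun g => (‖kernel f g g - kernelBorel ν 𝓕 f g g‖ₑ : ℝ≥0∞) with hDψ
  have hDψm : Measurable Dψ := by
    have hk : Measurable fun g : (quasiSplit F E c 3).Adelic => kernel f g g := by
      have h1 : Continuous fun x : (quasiSplit F E c 3).Adelic => (x, x) := continuous_id.prodMk continuous_id
      have hF : Continuous ((fun p : (quasiSplit F E c 3).Adelic × (quasiSplit F E c 3).Adelic =>
          kernel f p.1 p.2) ∘ fun x : (quasiSplit F E c 3).Adelic => (x, x)) :=
        Continuous.comp (continuous_kernel hfc hfs) h1
      exact hF.measurable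
    exact ((hk.sub (measurable_kernelBorel_diag hfc hfs ν 𝓕)).enorm).indicator
      (hDm.inter (measurableSet_setOf_lt_borelHeight T))
  -- the discrete subgroup `Γ = A_G · G(F) = G(F)` and the pointwise dichotomy over it
  haveI hΓd : DiscreteTopology (quasiSplit F E c 3).quotientSubgroup := by
    rw [quotientSubgroup_quasiSplit]; exact isDiscreteRational_quasiSplit
  set eΓ : (quasiSplit F E c 3).quotientSubgroup ≃ (quasiSplit F E c 3).arithmeticSubgroup :=
    (MulEquiv.subgroupCongr (quotientSubgroup_quasiSplit (F := F) (E := E) (c := c) (N := 3))).toEquiv with heΓ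
  have hpt : ∀ y : (quasiSplit F E c 3).Adelic, (‖truncatedKernel ν 𝓕 T f y‖ₑ : ℝ≥0∞) ≤
      ENNReal.ofReal Cb + ∑' γ : (quasiSplit F E c 3).quotientSubgroup,
        Dψ ((γ : (quasiSplit F E c 3).Adelic) * y) := by
    intro y
    have h := enorm_truncatedKernel_le_of_dichotomy hc ν h𝓕 f hT1 hCb hDcov y
    have hre : ∑' γ : (quasiSplit F E c 3).arithmeticSubgroup, Dψ ((γ : (quasiSplit F E c 3).Adelic) * y) =
        ∑' γ : (quasiSplit F E c 3).quotientSubgroup, Dψ ((γ : (quasiSplit F E c 3).Adelic) * y) := by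
      rw [← eΓ.tsum_eq]; rfl
    rw [← hre]
    exact h
  -- Weil's formula on `G ⧸ Γ` with the tree's Borel structure keyed on the syntactic form
  letI : MeasurableSpace ((quasiSplit F E c 3).Adelic ⧸ (quasiSplit F E c 3).quotientSubgroup) :=
    AdelicGroupData.measurableSpaceQuotientForm (quasiSplit F E c 3)
  haveI : BorelSpace ((quasiSplit F E c 3).Adelic ⧸ (quasiSplit F E c 3).quotientSubgroup) :=
    AdelicGroupData.borelSpaceQuotientForm (quasiSplit F E c 3)
  haveI : SMulInvariantMeasure (quasiSplit F E c 3).Adelic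
      ((quasiSplit F E c 3).Adelic ⧸ (quasiSplit F E c 3).quotientSubgroup) μ :=
    AdelicGroupData.smulInvariantMeasureQuotientForm (quasiSplit F E c 3) μ
  haveI : @IsFiniteMeasureOnCompacts ((quasiSplit F E c 3).Adelic ⧸ (quasiSplit F E c 3).quotientSubgroup) _ _ μ :=
    AdelicGroupData.isFiniteMeasureOnCompactsQuotientForm (quasiSplit F E c 3) μ
  -- the fibre sum of `Dψ ∘ inv` is the periodisation appearing in the dichotomy
  have hfib : ∀ x : (quasiSplit F E c 3).automorphicQuotient,
      ∑' γ : (quasiSplit F E c 3).quotientSubgroup,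
          Dψ ((γ : (quasiSplit F E c 3).Adelic) * (Quotient.out x)⁻¹) =
        fiberLIntegral (quasiSplit F E c 3).quotientSubgroup count (Dψ ∘ fun g => g⁻¹) x := by
    intro x
    conv_rhs => rw [← QuotientGroup.out_eq' x]
    rw [LevelOrbit.fiberLIntegral_count_mk]
    rw [← (Equiv.inv (quasiSplit F E c 3).quotientSubgroup).tsum_eq]
    refine tsum_congr fun γ => ?_
    simp only [Equiv.inv_apply, Function.comp_apply, Subgroup.coe_inv, _root_.mul_inv_rev]
  -- integrate
  have hlin : ∫⁻ x, (‖(quasiSplit F E c 3).quotFun (truncatedKernel ν 𝓕 T f) x‖ₑ : ℝ≥0∞) ∂μ ≤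
      ENNReal.ofReal Cb * μ Set.univ +
        unfoldingConstant (quasiSplit F E c 3).quotientSubgroup count μ νG *
          ∫⁻ g in D ∩ {g | T < borelHeight g}, ‖kernel f g g - kernelBorel ν 𝓕 f g g‖ₑ ∂νG := by
    calc ∫⁻ x, (‖(quasiSplit F E c 3).quotFun (truncatedKernel ν 𝓕 T f) x‖ₑ : ℝ≥0∞) ∂μ
        ≤ ∫⁻ x, (ENNReal.ofReal Cb +
            fiberLIntegral (quasiSplit F E c 3).quotientSubgroup count (Dψ ∘ fun g => g⁻¹) x) ∂μ := by
          refine lintegral_mono fun x => ?_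
          rw [← hfib x]
          exact hpt _
      _ = ENNReal.ofReal Cb * μ Set.univ +
          ∫⁻ x, fiberLIntegral (quasiSplit F E c 3).quotientSubgroup count (Dψ ∘ fun g => g⁻¹) x ∂μ := by
          rw [lintegral_add_left measurable_const, lintegral_const]
      _ = ENNReal.ofReal Cb * μ Set.univ +
          unfoldingConstant (quasiSplit F E c 3).quotientSubgroup count μ νG * ∫⁻ g, (Dψ ∘ fun g => g⁻¹) g ∂νG := by
          have hW := LevelOrbit.lintegral_fiberLIntegral_count_eq (quasiSplit F E c 3).quotientSubgroup μ νG
            (hDψm.comp measurable_inv)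
          exact congrArg (fun t => ENNReal.ofReal Cb * μ Set.univ + t) hW
      _ = ENNReal.ofReal Cb * μ Set.univ +
          unfoldingConstant (quasiSplit F E c 3).quotientSubgroup count μ νG * ∫⁻ g, Dψ g ∂νG := by
          congr 2
          exact lintegral_inv_eq_self Dψ
      _ = _ := by
          congr 2
          rw [hDψ, lintegral_indicator (hDm.inter (measurableSet_setOf_lt_borelHeight T))]
  have hfin : ∫⁻ x, (‖(quasiSplit F E c 3).quotFun (truncatedKernel ν 𝓕 T f) x‖ₑ : ℝ≥0∞) ∂μ < ∞ := by
    refine lt_of_le_of_lt hlin ?_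
    refine ENNReal.add_lt_top.2 ⟨ENNReal.mul_lt_top ENNReal.ofReal_lt_top (measure_lt_top μ _), ?_⟩
    exact ENNReal.mul_lt_top ENNReal.coe_lt_top hDint
  exact ⟨aestronglyMeasurable_quotFun_truncatedKernel hfc hfs ν h𝓕 hT0 μ, hfin⟩


end UnitaryGroup

end Literature.NumberTheory.Automorphic
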